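import Summits.HodgeConjecture.CorCM.D2Bridge.PrintedCitationHypothesesT
import Summits.HodgeConjecture.CorCM.HypD1pp.A4LiuD1ppIsotropyRankThree
import Summits.HodgeConjecture.CorCM.HypD1pp.A4LiuD1ppLemD1Item1AtV
import Summits.HodgeConjecture.CorCM.HypD1pp.A4LiuD1ppSplitPlaceModelConsequencesOfFacts
import Literature.RepresentationTheory.MoeglinVignerasWaldspurger1987.RankOneThetaLiftNonvanishingProofs
import Literature.RepresentationTheory.MoeglinVignerasWaldspurger1987.RankOneThetaLiftAdmissibleProofs
import Literature.NumberTheory.GelbartRogawski1991.UndoubledSplittingsUnitary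
import HarnessLib

/-!
# `hD1''` line `a4-liuD1pp` — the HEAD over the three still-open interface facts, IN THE TREE
# (cell `hodgecm-mathlib`, fan A ↔ fan B junction for the binder `HypD1pp` = stmt-HodgeConjecture-24838)

Summits side, binder subdirectory `CorCM/HypD1pp/`.  A-plan2's crux skeleton `a4-liuD1pp.lean` (2ff805ec0320d57a, REF1 PASS
2026-08-28T01:22:16Z) proves the binder `hD1''` = `PrintedCitationHypotheses.HypD1pp` ([Liu2021, Lem. D.1, first sentence + (1)] AS PRINTED,
per admissible index and finite place, at the face datum) from six stubs by the sorry-free compositions `lemD1AllPairs_of` /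
`HypD1pp_of`: instantiate fan B's generic per-place theorem at the face (`F ↦ F⁺`, `E ↦ F`, `N = n = 3`, `e = e₁`,
`J_V = diagonal (frameD V)`, `a = r_{a₀}(ε)`, `𝓢 = chiLocalSplittingsD …`, `μ = localMu (toHeckeCharacter μ)`, `χ₁ = χ.1`) and discharge
its one non-local hypothesis — UNITARITY of the local Weil representation of the face family — by the PROVED tree theorem
`GRConstruction.isL2Isometric_omegaLoc_congrW_undoubledSplittings_cmFinLocalFamily` at the Haar data of record `borelPlaceMeasure`.

This file lands those compositions AS TREE THEOREMS with every closed stub replaced by its tree name — stubs (2)(3) by the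
discharged facts `mvw_IV4_rankOne_admissible_holds` (B-p03 p595885) ∕ `mvw_IV2_rankOne_nonvanishing_of_isotropic_holds` (B-p04
p593652), stubs (4)(5)(6) by this directory's junction theorems `splitPlaceModelConsequences_of_facts` (p598915) ∕ `isotropyRankThree`
(p598544) ∕ `lemD1Item1AtV` (p599149) — so that ONLY the three still-open interface facts remain as hypotheses:
IV-1a `mvw_IV4_rankOne_irreducibleOrZero` [MoeglinVignerasWaldspurger1987, Chap. 3 IV.4 1a)], IV-3(a)
`Liu2021.splitPlace_chiCoinv_iso_parabolicIndGL` [Liu2021 l. 5253; GelbartRogawski1990 §2.6], IV-3(b)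
`Zelevinsky1980.parabolicIndGL_detChar_unitary_isIrreducible` [Zelevinsky1980 Thm 4.2]:

* `lemD1AllPairs_of_facts : IV-1a → IV-3(a) → IV-3(b) → <A's LemD1AllPairs, verbatim>` — Lem. D.1 (1) per place AT EVERY PAIR `(ε, χ)`
  (also the statement of a4-liu411's `stub_lemD1_allPairs`, consumer `Hyp411`);
* `hypD1pp_of_facts : IV-1a → IV-3(a) → IV-3(b) → PrintedCitationHypotheses.HypD1pp` (the pack decl of record, p588166, imported — not
  a copy); the route decl `Summit.HodgeConjecture.HodgeConjecture.Theses.HCCMUnconditional.HD1pp` delta-unfolds to it, so the closing file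
  of item 24838 is `HD1pp_proof := hypD1pp_of_facts IV1a_holds IV3a_holds IV3b_holds` the day the three `_holds` land.

CONDITIONAL on the three named facts only (D-0014).  HC_CM is proved only modulo the 7 printed citations (`hDel`, `h21`, `hLiu418`,
`h411`, `h413`, `hD3`, `hD1''`) until rung 0 closes; this file discharges no binder and no interface fact.

## References
* [Liu2021] Y. Liu, Camb. J. Math. 9 (2021) = arXiv:2102.11518, App. D Lemma D.1 (1) (l. 5246–5253), §D.1 Step 2 (l. 5219); Def. 4.11.
* [MoeglinVignerasWaldspurger1987] LNM 1291, Chap. 3 IV.2, IV.4.  [GelbartRogawski1991] §3.1 Prop. 3.1.1 (unitarity of the CM splittings).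
* [GelbartRogawski1990] §2.6.  [Zelevinsky1980] Thm 4.2.
-/

set_option autoImplicit false

noncomputable section

namespace Summit.HodgeConjecture.CorCM.HypD1pp

open scoped TensorProduct Matrix
open NumberField NumberField.InfinitePlace
open HodgeCM.Model HodgeCM.Model.LiuIndex HodgeCM.Model.TowerCarrier
open HodgeCM.Literature.Theta.LiuAlbaneseModuleDatum.D2Bridge (HcmPieces)
open Summit.HodgeConjecture.CorCM.Model
open Literature.AlgebraicGeometry.Motives (CMType)
open Literature.AlgebraicGeometry.HodgeTheory Literature.NumberTheory.Automorphic.PicardCM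
open Literature.AlgebraicGeometry.ShimuraVarieties.UnitaryCanonicalModel
open Literature.NumberTheory.ComplexMultiplication
open Literature.NumberTheory.Automorphic
open Literature.NumberTheory.Automorphic.IdeleClassGroup (toHeckeCharacter isUnitary_toHeckeCharacter galConj)
open Literature.NumberTheory.Automorphic.Liu2021 Literature.NumberTheory.Automorphic.Liu2021.AppendixC
open Literature.NumberTheory.Automorphic.Liu2021.AppendixC.RestOne
open Literature.NumberTheory.Automorphic.Liu2021.Def411WeilCarriers (lineOf locF Rep)
open Summit.HodgeConjecture.CorCM.Transposition.OmegaTransport (realUnit)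
open HodgeCM.Model.ArchSideTerm (e₁)
open Literature.NumberTheory.GelbartRogawski1991 Literature.NumberTheory.GelbartRogawski1991.UnitaryDualPair
open Literature.NumberTheory.GelbartRogawski1991.UnitaryDualPair.LocalSplitting (localMu norm_localMu continuous_localMu localMu_toLocalRing_eq_one_iff
  eq_of_forall_localMu_toHeckeCharacter_eq)
open Literature.RepresentationTheory Literature.RepresentationTheory.Liu2021
open Summit.HodgeConjecture.CorCM.Transposition
open Summit.HodgeConjecture.CorCM.D2Bridge.AdapterMuConj (muConj prop413AsPrinted_muConj def411_muConj nontrivial_omegaAt_muConj_rest)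
open Summit.HodgeConjecture.CorCM.D2Bridge.MuKeyIdentEnd (hc_cm_of_printed_citations_muKey_ident)
open Summit.HodgeConjecture.CorCM.D2Bridge.MuKeyIdentLemD3End
open Summit.HodgeConjecture.CorCM.D2Bridge.MuKeyIdentLemD3DelRecConjOmegaEnd (diagonal_frameD_map_complexConj)
open Summit.HodgeConjecture.CorCM.D2Bridge.MuKeyIdentLemD3DelRecConjOmegaEndT (hc_cm_of_printed_citations_muKey_ident_lemD3_delRecConjOmegaT)
open Summit.HodgeConjecture.CorCM.D2Bridge.MuKeyIdentLemD3DelRecConjOmegaEndT.PrintedCitationHypotheses (HypD1pp)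
open Literature.RepresentationTheory.MoeglinVignerasWaldspurger1987
  (mvw_IV4_rankOne_irreducibleOrZero mvw_IV4_rankOne_admissible mvw_IV2_rankOne_nonvanishing_of_isotropic
   mvw_IV4_rankOne_admissible_holds mvw_IV2_rankOne_nonvanishing_of_isotropic_holds)
open MeasureTheory

/-- **Lem. D.1 (1) per place AT EVERY PAIR `(ε, χ)` of the printed datum `D(μ)`, from the three open interface facts** — for every
face prefix (`F ⊇ ℚ` Galois CM of degree `≥ 6`, `ι₁`, `V`, `a`, `Φ ∋ ι₁`), every conjugate-symplectic weight-one `μ`, every pair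
`(ε, χ)` of `D(μ)` (admissible or not) and every finite place `v` of `F⁺`: `LemD1_1AsPrinted (localLemD1Data F⁺ F c 3 e₁ (diagonal (frameD V)) …
(r_{a₀}.toFun ε) (chiLocalSplittingsD … ε) (le_refl 3) (localMu μ) … χ.1 … v)`.  Statement = the body of A-plan2's
`Summit.HodgeConjecture.CorCM.Lines.A4LiuD1pp.LemD1AllPairs` (a4-liuD1pp.lean 2ff805ec0320d57a), character for character; proof = its
`lemD1AllPairs_of` with the closed stubs replaced by tree names: fan B's per-place theorem `lemD1Item1AtV` at the face, IV-1b∕IV-2 `_holds`,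
`splitPlaceModelConsequences_of_facts hIV3a hIV3b`, `isotropyRankThree`, and the unitarity discharge
`GRConstruction.isL2Isometric_omegaLoc_congrW_undoubledSplittings_cmFinLocalFamily` at `hχu := isUnitary_toHeckeCharacter F μ` and the Haar data
of record `borelPlaceMeasure` (on which `chiLocalSplittingsD` is built) [Liu2021, §D.1 Step 2; GelbartRogawski1991 §3.1 Prop. 3.1.1].
[cite: Liu2021, App. D Lem. D.1 (1) (l. 5246–5253), §D.1 Step 2 (l. 5219); Def. 4.11 (l. 2088–2096)]
[cite: GelbartRogawski1991, §3.1 Prop. 3.1.1 p. 455 L1–3] [cite: MoeglinVignerasWaldspurger1987, Chap. 3 IV.4 Thm principal 1a)] -/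
theorem lemD1AllPairs_of_facts (hIV1a : mvw_IV4_rankOne_irreducibleOrZero) (hIV3a : splitPlace_chiCoinv_iso_parabolicIndGL)
    (hIV3b : Zelevinsky1980.parabolicIndGL_detChar_unitary_isIrreducible.{0}) :
    ∀ (hDel : Literature.AlgebraicGeometry.ShimuraVarieties.UnitaryCanonicalModel.canonicalModel_exists_printed),
      ∀ (F : HodgeCM.CMField) [IsGalois ℚ F] (h6 : 6 ≤ Module.finrank ℚ F) {ι₁ : F →+* ℂ} (V : HodgeCM.HermSpace3 F ι₁) (a : RealScalar F)
      (Φ : CMType F) (hΦ : ι₁ ∈ Φ.1) (μ : Literature.NumberTheory.Automorphic.IdeleClassGroup (F : Type) →ₜ* Circle)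
      (hμ : IdeleClassGroup.IsConjugateSymplectic (F : Type) μ) (hw : IdeleClassGroup.HasWeight (F : Type) μ 1)
      (ε : (toThm418Data _ (restOfCharDeltaPrime (Summit.HodgeConjecture.CorCM.DelRec.exists_recordSystem_of_printed hDel) ⟨HodgeCM.CMField.K F⟩ h6 ι₁ ⟨HodgeCM.HermSpace3.Hm V, HodgeCM.HermSpace3.isHermitian V, HodgeCM.HermSpace3.signature_ι₁ V, HodgeCM.HermSpace3.posDef_of_ne V⟩ Φ e₁ (frameD V) (frameD_real V) (frameD_ne V) (ιVE V) (Rep.update ↥(maximalRealSubfield (HodgeCM.CMField.K F)) (imagUnitSq (HodgeCM.CMField.K F)) (Rep.ofLineOf ↥(maximalRealSubfield (HodgeCM.CMField.K F)) (imagUnitSq (HodgeCM.CMField.K F))) (locF ↥(maximalRealSubfield (HodgeCM.CMField.K F)) (imagUnitSq (HodgeCM.CMField.K F)) (realUnit ⟨HodgeCM.CMField.K F⟩ a.1 a.2.1 a.2.2)) (realUnit ⟨HodgeCM.CMField.K F⟩ a.1 a.2.1 a.2.2) rfl) μ hμ hw)).Eps)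
      (χ : (toThm418Data _ (restOfCharDeltaPrime (Summit.HodgeConjecture.CorCM.DelRec.exists_recordSystem_of_printed hDel) ⟨HodgeCM.CMField.K F⟩ h6 ι₁ ⟨HodgeCM.HermSpace3.Hm V, HodgeCM.HermSpace3.isHermitian V, HodgeCM.HermSpace3.signature_ι₁ V, HodgeCM.HermSpace3.posDef_of_ne V⟩ Φ e₁ (frameD V) (frameD_real V) (frameD_ne V) (ιVE V) (Rep.update ↥(maximalRealSubfield (HodgeCM.CMField.K F)) (imagUnitSq (HodgeCM.CMField.K F)) (Rep.ofLineOf ↥(maximalRealSubfield (HodgeCM.CMField.K F)) (imagUnitSq (HodgeCM.CMField.K F))) (locF ↥(maximalRealSubfield (HodgeCM.CMField.K F)) (imagUnitSq (HodgeCM.CMField.K F)) (realUnit ⟨HodgeCM.CMField.K F⟩ a.1 a.2.1 a.2.2)) (realUnit ⟨HodgeCM.CMField.K F⟩ a.1 a.2.1 a.2.2) rfl) μ hμ hw)).Chi) (v : IsDedekindDomain.HeightOneSpectrum (𝓞 ↥(maximalRealSubfield (F : Type)))),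
      LemD1_1AsPrinted
        (Def411WeilCarriers.localLemD1Data ↥(maximalRealSubfield (F : Type)) (F : Type) (IsCMField.complexConj (F : Type)) 3 e₁
          (Matrix.diagonal (frameD V)) (complexConj_imagUnit (F : Type)) (imagUnit_ne_zero (F : Type)) (imagUnit_mul_self (F : Type))
          (realDiagonal_isSymm (F : Type) (frameD V) (frameD_real V)) (isUnit_det_realDiagonal (F : Type) (frameD V) (frameD_real V) (frameD_ne V))
          (realDiagonal_map (F : Type) (frameD V) (frameD_real V)).symm (((Rep.update ↥(maximalRealSubfield (HodgeCM.CMField.K F)) (imagUnitSq (HodgeCM.CMField.K F)) (Rep.ofLineOf ↥(maximalRealSubfield (HodgeCM.CMField.K F)) (imagUnitSq (HodgeCM.CMField.K F))) (locF ↥(maximalRealSubfield (HodgeCM.CMField.K F)) (imagUnitSq (HodgeCM.CMField.K F)) (realUnit ⟨HodgeCM.CMField.K F⟩ a.1 a.2.1 a.2.2)) (realUnit ⟨HodgeCM.CMField.K F⟩ a.1 a.2.1 a.2.2) rfl)).toFun ε)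
          (OmegaChiSplitting.chiLocalSplittingsD ⟨HodgeCM.CMField.K F⟩ e₁ (frameD V) (frameD_real V) (frameD_ne V) (toHeckeCharacter (F : Type) μ)
            ((isOscillatorChar_toHeckeCharacter_iff μ).mpr hμ) (((Rep.update ↥(maximalRealSubfield (HodgeCM.CMField.K F)) (imagUnitSq (HodgeCM.CMField.K F)) (Rep.ofLineOf ↥(maximalRealSubfield (HodgeCM.CMField.K F)) (imagUnitSq (HodgeCM.CMField.K F))) (locF ↥(maximalRealSubfield (HodgeCM.CMField.K F)) (imagUnitSq (HodgeCM.CMField.K F)) (realUnit ⟨HodgeCM.CMField.K F⟩ a.1 a.2.1 a.2.2)) (realUnit ⟨HodgeCM.CMField.K F⟩ a.1 a.2.1 a.2.2) rfl)).toFun ε))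
          (le_refl 3) (localMu (F : Type) (toHeckeCharacter (F : Type) μ))
          (fun v x => norm_localMu (F : Type) (toHeckeCharacter (F : Type) μ) v (isUnitary_toHeckeCharacter (F : Type) μ) x)
          (continuous_localMu (F : Type) (toHeckeCharacter (F : Type) μ))
          (fun v t => localMu_toLocalRing_eq_one_iff (F : Type) (toHeckeCharacter (F : Type) μ) v ((isOscillatorChar_toHeckeCharacter_iff μ).mpr hμ) t)
          χ.1
          (Def411WeilCarriers.norm_chi_eq_one ↥(maximalRealSubfield (F : Type)) (F : Type) (IsCMField.complexConj (F : Type))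
            (Algebra.IsQuadraticExtension.finrank_eq_two ↥(maximalRealSubfield (F : Type)) (F : Type))
            (UnitaryGroup.algEquiv_ne_one_of_apply_eq_neg ↥(maximalRealSubfield (F : Type)) (F : Type) (IsCMField.complexConj (F : Type))
              (complexConj_imagUnit (F : Type)) (imagUnit_ne_zero (F : Type))) χ)
          χ.2.1 v) := by
  intro hDel F _ h6 ι₁ V a Φ hΦ μ hμ hw ε χ v
  letI : MeasurableSpace (v.adicCompletion ↥(maximalRealSubfield (HodgeCM.CMField.K F))) :=
    (GRConstruction.borelPlaceMeasure (HodgeCM.CMField.K F) v).mS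
  haveI : BorelSpace (v.adicCompletion ↥(maximalRealSubfield (HodgeCM.CMField.K F))) :=
    (GRConstruction.borelPlaceMeasure (HodgeCM.CMField.K F) v).isBorel
  haveI : (GRConstruction.borelPlaceMeasure (HodgeCM.CMField.K F) v).μ.IsAddHaarMeasure :=
    (GRConstruction.borelPlaceMeasure (HodgeCM.CMField.K F) v).isHaar
  exact lemD1Item1AtV _ _ _ _ _ _ _ _ _ _ _ _ _ _ _ _ _ _ _ _ _ _ v hIV1a mvw_IV4_rankOne_admissible_holds
    mvw_IV2_rankOne_nonvanishing_of_isotropic_holds (GRConstruction.borelPlaceMeasure (HodgeCM.CMField.K F) v).μ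
    (GRConstruction.isL2Isometric_omegaLoc_congrW_undoubledSplittings_cmFinLocalFamily _ _ _ _ _ _ _ _ _ _ _ v
      (isUnitary_toHeckeCharacter (F : Type) μ) _ _ _ _ _)
    (splitPlaceModelConsequences_of_facts hIV3a hIV3b _ _ _ _ _ _ _ _ _ (realDiagonal_isSymm (F : Type) (frameD V) (frameD_real V))
      (isUnit_det_realDiagonal (F : Type) (frameD V) (frameD_real V) (frameD_ne V)) (realDiagonal_map (F : Type) (frameD V) (frameD_real V)).symm
      _ _ (le_refl 3) _
      (Def411WeilCarriers.norm_chi_eq_one ↥(maximalRealSubfield (F : Type)) (F : Type) (IsCMField.complexConj (F : Type))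
        (Algebra.IsQuadraticExtension.finrank_eq_two ↥(maximalRealSubfield (F : Type)) (F : Type))
        (UnitaryGroup.algEquiv_ne_one_of_apply_eq_neg ↥(maximalRealSubfield (F : Type)) (F : Type) (IsCMField.complexConj (F : Type))
          (complexConj_imagUnit (F : Type)) (imagUnit_ne_zero (F : Type))) χ)
      χ.2.1 v _) (isotropyRankThree _ _ _ _ _ _ _ _ _ _ _ _ _ _ _ _ _ _ _ _ _ _ v)

/-- **`hD1''` = `PrintedCitationHypotheses.HypD1pp` FROM THE THREE OPEN INTERFACE FACTS** — [Liu2021, Lem. D.1, first sentence + (1)] AS PRINTED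
at the face datum, per ADMISSIBLE index `j` and finite place `v`, i.e. the binder `hD1''` of the headline
`hc_cm_of_printed_citations_muKey_ident_lemD3_delRecConjOmegaT` closed over `hDel` (the pack decl of record, p588166 — to which the route decl
`Summit.HodgeConjecture.HodgeConjecture.Theses.HCCMUnconditional.HD1pp` delta-unfolds), GIVEN IV-1a `mvw_IV4_rankOne_irreducibleOrZero`,
IV-3(a) `splitPlace_chiCoinv_iso_parabolicIndGL`, IV-3(b) `parabolicIndGL_detChar_unitary_isIrreducible`: restriction of
`lemD1AllPairs_of_facts` to admissible indices (`j ↦ (j.1.1, j.1.2)`; A-plan2's `hypD1pp_of_allPairs` ∘ `lemD1AllPairs_of`).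
[cite: Liu2021, App. D Lem. D.1 (1) (l. 5246–5253); Thm. 4.18 (index set)] -/
theorem hypD1pp_of_facts (hIV1a : mvw_IV4_rankOne_irreducibleOrZero) (hIV3a : splitPlace_chiCoinv_iso_parabolicIndGL)
    (hIV3b : Zelevinsky1980.parabolicIndGL_detChar_unitary_isIrreducible.{0}) : HypD1pp :=
  fun hDel F _ h6 _ V a Φ hΦ μ hμ hw j v => lemD1AllPairs_of_facts hIV1a hIV3a hIV3b hDel F h6 V a Φ hΦ μ hμ hw j.1.1 j.1.2 v

end Summit.HodgeConjecture.CorCM.HypD1pp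

end
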